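import Literature.Probability.Percolation.BoxCrossingUpperBound
import Summits.CriticalPhenomena.CardyFormulaZ2.Theorems.CardyComplexConeSLESixFamiliesGiveCardyDefs

/-!
# drefute gen-6 — CONNECTOR EXCLUSION for STUB A `stub_upperFence` (crux `SLESixFamiliesGiveCardy`,
stmt-CriticalPhenomena-9654, line `collar-touch-sandwich`)

In the fence argument the cross-cut is `[f_x, δx] ∪ (open crossing π) ∪ [δy, f_y]`, where
`[δx, f_x]` is the initial piece of a lattice edge `{x, x'}` that is NOT an edge of `Ω_δ`
(`x ∈ (ab)_δ` is a discrete-boundary site; `f_x` its first frontier point).  If the exploration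
polygon met this connector, `{x, x'}` would be a crossed, hence `D_δ`-, edge.  This file proves
that this cannot happen: at a small mesh, a non-`Ω_δ` lattice edge at a site of the discrete arc of
`R.arc 0` (resp. `R.arc 2`) is NOT an edge of the collared discrete domain `D_δ` — by the three
cases `δx' ∉ closure Ω` (`closure_far`), `δx' ∈ ∂Ω` (`near_arc_zero/two`: then `δx' ∈ ∂D`, not in
the open `D`), `δx' ∈ Ω` (same mesh component, or the edge leaves `closure Ω` inside `closure D`:
`closure_far`).  NOTE for the lead: the tree's exit lemma
`exists_frontier_exit_of_mem_meshBoundary` FORGETS that its neighbour is a non-`Ω_δ`-neighbour; take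
the neighbour from `mem_meshBoundary_iff'` (as `exists_mem_frontier_of_mem_meshBoundary` does
internally) so that `hnadj` below is available.  Positive helper, NOT a refutation.
`lean check`: rc 0, 0 sorries, 0 warnings.
-/

noncomputable section

open Set Filter Topology Metric
open Literature.Probability Literature.Probability.RandomPlanarGeometry
  Literature.Probability.LatticeModels Literature.Probability.Percolation

namespace Summit.CriticalPhenomena.CardyFormulaZ2.Cruxes.SLESixFamiliesGiveCardy.CollarTouchSandwich

namespace DrefuteG6

/-- **Connector exclusion, deterministic kernel.**  `Ω ⊆ D` open sets, `A` a set ("the arc read by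
the crossing event") such that frontier points of `Ω` within `r` of `A` are frontier points of
`D`, and points of `closure D` outside `closure Ω` are `≥ s` away from `A`; mesh `0 < δ` with
`2δ < r`, `2δ < s`.  Then a lattice edge `{x, y}` at a site `x` of the discrete arc of `A` which is
not an edge of `Ω_δ` is not an edge of `D_δ` either. [folklore] -/
theorem connector_not_adj_of_far {Ω D A : Set ℂ} (hΩ : IsOpen Ω) (hD : IsOpen D)
    {r s δ : ℝ} (hδ : 0 < δ) (hδr : 2 * δ < r) (hδs : 2 * δ < s)
    (hnear : ∀ z ∈ frontier Ω, infDist z A < r → z ∈ frontier D)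
    (hfar : ∀ z ∈ closure D, z ∉ closure Ω → s ≤ infDist z A)
    {x y : Site 2} (hx : x ∈ discreteArc Ω δ A) (hxy : (zdGraph 2).Adj x y)
    (hnadj : ¬ (discreteDomainGraph Ω δ).Adj x y) :
    ¬ (discreteDomainGraph D δ).Adj x y := by
  intro hD'
  obtain ⟨hmesh, -, hyD⟩ := discreteDomainGraph_adj_iff.1 hD'
  obtain ⟨-, hsegD⟩ := meshGraph_adj_iff.1 hmesh
  have hyDm : meshPoint δ y ∈ D := meshDomain_subset_meshVertices D δ hyD
  obtain ⟨hxB, hxle⟩ := mem_discreteArc_iff.1 hx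
  have hdxy : dist (meshPoint δ x) (meshPoint δ y) = δ := by
    rw [dist_meshPoint_of_adj hxy, abs_of_pos hδ]
  -- `infDist (δx) A ≤ δ`
  have hxA : infDist (meshPoint δ x) A ≤ δ := by
    obtain ⟨y', hxy', w, hw, hwfr⟩ := exists_mem_frontier_of_mem_meshBoundary hΩ hxB
    have hdw : dist (meshPoint δ x) w ≤ δ := by
      have h1 : w ∈ closedBall (meshPoint δ x) δ :=
        (convex_closedBall _ _).segment_subset (mem_closedBall_self hδ.le)
          (by rw [mem_closedBall, dist_comm, dist_meshPoint_of_adj hxy', abs_of_pos hδ]) hw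
      rw [mem_closedBall, dist_comm] at h1
      exact h1
    by_cases hwA : w ∈ A
    · exact (infDist_le_dist_of_mem hwA).trans hdw
    · have hw' : w ∈ frontier Ω \ A := ⟨hwfr, hwA⟩
      exact hxle.trans ((infDist_le_dist_of_mem hw').trans hdw)
  by_cases hycl : meshPoint δ y ∈ closure Ω
  · by_cases hyΩ : meshPoint δ y ∈ Ω
    · by_cases hseg : segment ℝ (meshPoint δ x) (meshPoint δ y) ⊆ closure Ω
      · -- same mesh component: `{x, y}` would be an `Ω_δ`-edge
        have hadj : (meshGraph Ω δ).Adj x y := meshGraph_adj_iff.2 ⟨hxy, hseg⟩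
        exact hnadj (discreteDomainGraph_adj_iff.2
          ⟨hadj, hxB.1, mem_meshDomain_of_meshGraph_adj hxB.1 hyΩ hadj⟩)
      · -- the edge leaves `closure Ω` inside `closure D`
        rw [Set.not_subset] at hseg
        obtain ⟨p, hp, hpcl⟩ := hseg
        have hps : s ≤ infDist p A := hfar p (hsegD hp) hpcl
        have hdp : dist p (meshPoint δ x) ≤ δ := by
          have : p ∈ closedBall (meshPoint δ x) δ :=
            (convex_closedBall _ _).segment_subset (mem_closedBall_self hδ.le)
              (by rw [mem_closedBall, dist_comm, hdxy]) hp
          exact mem_closedBall.1 this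
        have := infDist_le_infDist_add_dist (x := p) (y := meshPoint δ x) (s := A)
        linarith
    · -- `δy ∈ ∂Ω` near `A`, hence on `∂D`, not in the open `D`
      have hyfr : meshPoint δ y ∈ frontier Ω := by
        rw [frontier_eq_closure_inter_closure]
        exact ⟨hycl, subset_closure hyΩ⟩
      have hyA : infDist (meshPoint δ y) A < r := by
        have := infDist_le_infDist_add_dist (x := meshPoint δ y) (y := meshPoint δ x) (s := A)
        rw [dist_comm] at this
        linarith
      have hmem : meshPoint δ y ∈ D ∩ frontier D := ⟨hyDm, hnear _ hyfr hyA⟩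
      rw [hD.inter_frontier_eq] at hmem
      exact hmem
  · -- `δy ∉ closure Ω`: a point of `closure D` outside `closure Ω` within `2δ` of `A`
    have hys : s ≤ infDist (meshPoint δ y) A := hfar _ (subset_closure hyDm) hycl
    have := infDist_le_infDist_add_dist (x := meshPoint δ y) (y := meshPoint δ x) (s := A)
    rw [dist_comm] at this
    linarith

/-- **Connector exclusion under `UpperCollarGeom`, eventually in the mesh**, at both ends of the
crossing (`k = 0`: the arc `(ab)`, wired side; `k = 2`: the arc `(cd)`, dual side). [folklore] -/
theorem UpperCollarGeom.eventually_connector_not_adj {R : ConformalRectangle} {D : DobrushinDomain}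
    {G : Set ℂ} (hg : UpperCollarGeom R D G) :
    ∀ᶠ δ : ℝ in 𝓝[>] 0, ∀ k : Fin 4, (k = 0 ∨ k = 2) →
      ∀ x ∈ discreteArc R.carrier δ (R.arc k), ∀ y : Site 2, (zdGraph 2).Adj x y →
        ¬ (discreteDomainGraph R.carrier δ).Adj x y → ¬ (discreteDomainGraph D.carrier δ).Adj x y := by
  obtain ⟨r₀, hr₀, h₀⟩ := hg.near_arc_zero
  obtain ⟨r₂, hr₂, h₂⟩ := hg.near_arc_two
  obtain ⟨s, hs, hfar⟩ := hg.closure_far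
  have hm : 0 < min (min r₀ r₂) s / 2 := by positivity
  filter_upwards [Ioo_mem_nhdsGT hm] with δ hδ k hk x hx y hxy hnadj
  have hδ0 : 0 < δ := hδ.1
  have h1 : min (min r₀ r₂) s ≤ r₀ := (min_le_left _ _).trans (min_le_left _ _)
  have h2 : min (min r₀ r₂) s ≤ r₂ := (min_le_left _ _).trans (min_le_right _ _)
  have h3 : min (min r₀ r₂) s ≤ s := min_le_right _ _
  have hδ' := hδ.2
  rcases hk with rfl | rfl
  · exact connector_not_adj_of_far R.isOpen D.isOpen hδ0 (by linarith) (by linarith)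
      (fun z hz hzA => D.arc_subset_frontier 0 (h₀ z hz hzA))
      (fun z hz hzΩ => (hfar z hz hzΩ).1) hx hxy hnadj
  · exact connector_not_adj_of_far R.isOpen D.isOpen hδ0 (by linarith) (by linarith)
      (fun z hz hzA => D.arc_subset_frontier 1 (h₂ z hz hzA))
      (fun z hz hzΩ => (hfar z hz hzΩ).2) hx hxy hnadj

/-- **First frontier exit KEEPING the non-adjacency** (the form the fence argument needs; cf. the
tree's `exists_frontier_exit_of_mem_meshBoundary`, which drops `hnadj`).  A discrete boundary site
`x ∈ ∂Ω_δ` has a lattice neighbour `y` that is NOT an `Ω_δ`-neighbour, and a first frontier point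
`f` on `[δx, δy]`: the initial piece `[δx, f]` lies in `closure Ω` and its points other than `f`
lie in `Ω`. [folklore] -/
theorem exists_frontier_exit_not_adj {Ω : Set ℂ} (hΩ : IsOpen Ω) {δ : ℝ} {x : Site 2}
    (hx : x ∈ meshBoundary Ω δ) :
    ∃ (y : Site 2) (f : ℂ), (zdGraph 2).Adj x y ∧ ¬ (discreteDomainGraph Ω δ).Adj x y ∧
      f ∈ frontier Ω ∧ f ∈ segment ℝ (meshPoint δ x) (meshPoint δ y) ∧
      segment ℝ (meshPoint δ x) f ⊆ closure Ω ∧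
      (∀ z ∈ segment ℝ (meshPoint δ x) f, z ≠ f → z ∈ Ω) := by
  obtain ⟨hxD, y, hxy, hy⟩ := mem_meshBoundary_iff.1 hx
  have hxΩ : meshPoint δ x ∈ Ω := meshDomain_subset_meshVertices Ω δ hxD
  -- the edge is not inside `Ω` (else it would be an `Ω_δ`-edge)
  have hseg : ¬ segment ℝ (meshPoint δ x) (meshPoint δ y) ⊆ Ω := by
    intro h
    have hadj : (meshGraph Ω δ).Adj x y := meshGraph_adj_iff.2 ⟨hxy, h.trans subset_closure⟩
    have hyΩ : meshPoint δ y ∈ Ω := h (right_mem_segment ℝ _ _)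
    exact hy (discreteDomainGraph_adj_iff.2 ⟨hadj, hxD, mem_meshDomain_of_meshGraph_adj hxD hyΩ hadj⟩)
  obtain ⟨t, ht0, ht1, hfr, -, hbefore⟩ := exists_first_exit hΩ hxΩ hseg
  set p := meshPoint δ x with hp
  set q := meshPoint δ y with hq
  refine ⟨y, p + t • (q - p), hxy, hy, hfr, ?_, ?_, ?_⟩
  · rw [segment_eq_image']
    exact ⟨t, ⟨ht0.le, ht1⟩, rfl⟩
  · intro z hz
    obtain ⟨θ, hθ, rfl⟩ := exists_param_of_mem_subsegment hz
    rcases hθ.2.eq_or_lt with rfl | hθ1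
    · rw [one_mul]
      exact frontier_subset_closure hfr
    · exact subset_closure (hbefore _ (mul_nonneg hθ.1 ht0.le) (by nlinarith))
  · intro z hz hne
    obtain ⟨θ, hθ, rfl⟩ := exists_param_of_mem_subsegment hz
    rcases hθ.2.eq_or_lt with rfl | hθ1
    · exact absurd (by rw [one_mul]) hne
    · exact hbefore _ (mul_nonneg hθ.1 ht0.le) (by nlinarith)

end DrefuteG6

end Summit.CriticalPhenomena.CardyFormulaZ2.Cruxes.SLESixFamiliesGiveCardy.CollarTouchSandwich
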